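import Mathlib.RingTheory.ZMod.UnitsCyclic
import Mathlib.NumberTheory.Multiplicity
import Mathlib.RingTheory.AdjoinRoot
import Mathlib.Algebra.Polynomial.SpecificDegree
import Mathlib.FieldTheory.Finite.Basic
import Mathlib.FieldTheory.Finiteness
import Mathlib.Algebra.MonoidAlgebra.Basic
import Mathlib.Algebra.CharP.Lemmas
import Mathlib.GroupTheory.SpecificGroups.Cyclic
import HarnessLib

/-!
# Route `SignedLowerHalves`, crux L `SmallImageLowerHalfBothSigns` (item stmt-BirchSwinnertonDyer-23599), line `rtt_w3` — crux idea `valve`,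
# brick B2 (depleted primitivity), ALGEBRA HALF: the annihilator lemma in `𝔽_p[(ℤ/p^N)ˣ]`

Width seat `bsd-line-slh-p3-w3` g15 under LEAD `cruxlead-stmt-BirchSwinnertonDyer-23599` (cell `bsd-ssimc`); ROUTE-INDEPENDENT helper
(`--supports stmt-BirchSwinnertonDyer-23599`); Mathlib only; THEOREMS ONLY (no definition, no named fact, no `sorry`); closes nothing; BSD / crux L
/ crux M are proved for NO curve by this. WHY: the valve kernel (`…ValveKernel.lean`, p758736) needs brick B2 — the `S₀`-depleted plus symbol
`Σ_k (∏_ℓ c_{ℓ,k_ℓ} ℓ^{−k_ℓ})·[x ∏ℓ^{k_ℓ}]⁺_f` of `W`'s newform is a `p`-unit at SOME cusp. The sequel `…ValveDepletion.lean` proves it by an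
IHARA-FREE road (THEOREM B + the Hecke relation at `p` with `a_p = 0`); this file is the algebra: if the depletion operator
`E = ∏_i Q_i(δ_{σ_i⁻¹})` kills `θ̄ ∈ 𝔽_p[(ℤ/p^N)ˣ]`, then `θ̄` is invariant under `1 + p^{N−1}`, i.e. constant on the fibres of
`(ℤ/p^N)ˣ → (ℤ/p^{N−1})ˣ`. §1 `dvd_X_pow_sub_one_sq`: `Q ∈ 𝔽_p[Y]`, `deg Q ≤ 2`, `Q(0) ≠ 0` ⟹ `Q ∣ (Y^{p²−1} − 1)²` (irreducible case:
`AdjoinRoot Q` is the field with `p²` elements). §2 `(ℤ/p^N)ˣ`, `p` odd: `mem_zpowers_of_orderOf_dvd`, `(1+p^{N−1−b})^{p^b} = 1+p^{N−1}`,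
`(1+p^{N−1})^m = 1+mp^{N−1}`, `1+p^{N−1−b} ∈ ⟨ℓ^{p²−1}⟩` for `N ≥ v_p(ℓ^{p²−1}−1)+b+1`. §3 ★ `single_mul_eq_self_of_depletion_mul_eq_zero`:
`E·θ = 0 ⟹ δ_{1+p^{N−1}}·θ = θ` (`Q_i(δ)C_i(δ) = (δ^{p²−1}−1)²`, geometric series, Frobenius `(δ_{g₁}−1)^{p^b} = δ_{g₁^{p^b}}−1`, `2#ι ≤ p^b`).
§4 ★ `apply_mul_pow_eq_of_depletion_sum_eq_zero` / `exists_unit_eq_add_mul_and_apply_eq`: the same for a FUNCTION `c : (ℤ/p^N)ˣ → 𝔽_p`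
all of whose depleted values `Σ_k (∏_i [Y^{k_i}]Q_i)·c(∏σ_i^{k_i}·a)` vanish: `c` is constant on every fibre `{a + t p^{N−1}}`.
References: [MazurTateTeitelbaum1986Invent] §I.4 (4.2); [GreenbergVatsal2000] §1 (8)–(9); [Washington1997] §7.2.
-/

set_option autoImplicit false
-- D-0017: single-problem summit, the namespace repeats the problem name by design.
set_option linter.dupNamespace false
noncomputable section

open scoped Classical
open Polynomial

namespace Summit.BirchSwinnertonDyer.BirchSwinnertonDyer.Theorems.SmallImageValve

variable {p : ℕ} [hp : Fact p.Prime]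

/-! ## §1 Polynomials of degree `≤ 2` over `𝔽_p` with nonzero constant term divide `(Y^{p²−1} − 1)²` -/

/-- A linear factor `Y − r`, `r ∈ 𝔽_pˣ`, divides `Y^{p²−1} − 1` (`r^{p−1} = 1`). [folklore] -/
theorem X_sub_C_dvd_X_pow_sub_one {r : ZMod p} (hr : r ≠ 0) :
    (X - C r : (ZMod p)[X]) ∣ X ^ (p ^ 2 - 1) - 1 := by
  have hsq : p ^ 2 - 1 = (p - 1) * (p + 1) := by simpa [mul_comm] using Nat.sq_sub_sq p 1
  rw [dvd_iff_isRoot]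
  simp only [IsRoot.def, eval_sub, eval_pow, eval_X, eval_one, hsq, pow_mul,
    ZMod.pow_card_sub_one_eq_one hr, one_pow, sub_self]

/-- A polynomial of degree `≤ 1` over `𝔽_p` with nonzero constant term divides `Y^{p²−1} − 1`. [folklore] -/
theorem dvd_X_pow_sub_one_of_natDegree_le_one {Q : (ZMod p)[X]} (hdeg : Q.natDegree ≤ 1) (h0 : Q.coeff 0 ≠ 0) :
    Q ∣ (X : (ZMod p)[X]) ^ (p ^ 2 - 1) - 1 := by
  rcases Nat.le_one_iff_eq_zero_or_eq_one.mp hdeg with hd | hd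
  · rw [eq_C_of_natDegree_eq_zero hd]
    exact (isUnit_C.mpr (isUnit_iff_ne_zero.mpr h0)).dvd
  · obtain ⟨r, hr⟩ := exists_root_of_degree_eq_one ((degree_eq_iff_natDegree_eq_of_pos one_pos).mpr hd)
    have hr0 : r ≠ 0 := by rintro rfl; rw [IsRoot.def, ← coeff_zero_eq_eval_zero] at hr; exact h0 hr
    have hfac := (mul_divByMonic_eq_iff_isRoot (p := Q) (a := r)).mpr hr
    have hd1 : (Q /ₘ (X - C r)).natDegree = 0 := by rw [natDegree_divByMonic _ (monic_X_sub_C r), hd]; simp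
    have hq0 : (Q /ₘ (X - C r)).coeff 0 ≠ 0 := by
      intro h
      have : Q.coeff 0 = 0 := by rw [← hfac, mul_coeff_zero, h, mul_zero]
      exact h0 this
    rw [← hfac, eq_C_of_natDegree_eq_zero hd1]
    exact (IsUnit.mul_right_dvd (isUnit_C.mpr (isUnit_iff_ne_zero.mpr hq0))).mpr (X_sub_C_dvd_X_pow_sub_one hr0)

/-- An IRREDUCIBLE quadratic over `𝔽_p` divides `Y^{p²−1} − 1`: `AdjoinRoot Q` is the field with `p²` elements and its generator is a
nonzero element, so `y^{p²−1} = 1`. [folklore] -/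
theorem dvd_X_pow_sub_one_of_irreducible {Q : (ZMod p)[X]} (hirr : Irreducible Q) (hdeg : Q.natDegree = 2) :
    Q ∣ (X : (ZMod p)[X]) ^ (p ^ 2 - 1) - 1 := by
  haveI := Fact.mk hirr
  have hQ0 : Q ≠ 0 := hirr.ne_zero
  haveI : Module.Finite (ZMod p) (AdjoinRoot Q) := (AdjoinRoot.powerBasis hQ0).finite
  haveI : Finite (AdjoinRoot Q) := Module.finite_of_finite (ZMod p)
  letI : Fintype (AdjoinRoot Q) := Fintype.ofFinite _
  have hcard : Fintype.card (AdjoinRoot Q) = p ^ 2 := by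
    rw [Fintype.card_eq_nat_card, Module.natCard_eq_pow_finrank (K := ZMod p), Nat.card_zmod,
      (AdjoinRoot.powerBasis hQ0).finrank, AdjoinRoot.powerBasis_dim, hdeg]
  have hroot0 : AdjoinRoot.root Q ≠ 0 := by
    intro h
    rw [← AdjoinRoot.mk_X, AdjoinRoot.mk_eq_zero] at h
    have := natDegree_le_of_dvd h X_ne_zero
    rw [natDegree_X, hdeg] at this
    omega
  have hpow : AdjoinRoot.root Q ^ (p ^ 2 - 1) = 1 := by
    have := FiniteField.pow_card_sub_one_eq_one (AdjoinRoot.root Q) hroot0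
    rwa [hcard] at this
  rw [← AdjoinRoot.mk_eq_zero, map_sub, map_pow, AdjoinRoot.mk_X, map_one, hpow, sub_self]

/-- ★ §1: **every `Q ∈ 𝔽_p[Y]` of degree `≤ 2` with `Q(0) ≠ 0` divides `(Y^{p²−1} − 1)²`** (split case: two roots in `𝔽_pˣ`;
degree `≤ 1`; irreducible quadratic). Applied to the mod-`p` Euler factors `L_ℓ(ℓ⁻¹Y)` of the depletion. [folklore] -/
theorem dvd_X_pow_sub_one_sq {Q : (ZMod p)[X]} (hdeg : Q.natDegree ≤ 2) (h0 : Q.coeff 0 ≠ 0) :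
    Q ∣ ((X : (ZMod p)[X]) ^ (p ^ 2 - 1) - 1) ^ 2 := by
  by_cases hd2 : Q.natDegree ≤ 1
  · exact (dvd_X_pow_sub_one_of_natDegree_le_one hd2 h0).trans (dvd_pow_self _ two_ne_zero)
  have hdeg2 : Q.natDegree = 2 := by omega
  by_cases hroot : ∃ r, Q.IsRoot r
  · obtain ⟨r, hr⟩ := hroot
    have hr0 : r ≠ 0 := by rintro rfl; rw [IsRoot.def, ← coeff_zero_eq_eval_zero] at hr; exact h0 hr
    have hfac := (mul_divByMonic_eq_iff_isRoot (p := Q) (a := r)).mpr hr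
    have hd1 : (Q /ₘ (X - C r)).natDegree ≤ 1 := by rw [natDegree_divByMonic _ (monic_X_sub_C r), hdeg2]; simp
    have hq0 : (Q /ₘ (X - C r)).coeff 0 ≠ 0 := by
      intro h
      have : Q.coeff 0 = 0 := by rw [← hfac, mul_coeff_zero, h, mul_zero]
      exact h0 this
    rw [← hfac, pow_two]
    exact mul_dvd_mul (X_sub_C_dvd_X_pow_sub_one hr0) (dvd_X_pow_sub_one_of_natDegree_le_one hd1 hq0)
  · push Not at hroot
    have hirr : Irreducible Q := irreducible_of_degree_le_three_of_not_isRoot (by rw [Finset.mem_Icc]; omega) hroot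
    exact (dvd_X_pow_sub_one_of_irreducible hirr hdeg2).trans (dvd_pow_self _ two_ne_zero)

/-! ## §2 The group `(ℤ/p^N)ˣ` at an odd prime -/

/-- In a finite cyclic group, `orderOf y ∣ orderOf x ⟹ y ∈ ⟨x⟩` (`⟨x⟩` is the kernel of `g ↦ g^{ord x}`, by cardinality). [folklore] -/
theorem mem_zpowers_of_orderOf_dvd {G : Type*} [CommGroup G] [Finite G] [IsCyclic G] {x y : G}
    (h : orderOf y ∣ orderOf x) : y ∈ Subgroup.zpowers x := by
  have hle : Subgroup.zpowers x ≤ (powMonoidHom (orderOf x) : G →* G).ker := by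
    intro g hg
    obtain ⟨k, rfl⟩ := Subgroup.mem_zpowers_iff.mp hg
    rw [MonoidHom.mem_ker, powMonoidHom_apply, ← zpow_natCast, ← zpow_mul, mul_comm, zpow_mul, zpow_natCast,
      pow_orderOf_eq_one, one_zpow]
  have hcard : Nat.card (powMonoidHom (orderOf x) : G →* G).ker ≤ Nat.card (Subgroup.zpowers x) := by
    rw [IsCyclic.card_powMonoidHom_ker, Nat.card_zpowers, Nat.gcd_eq_right (orderOf_dvd_natCard x)]
  rw [Subgroup.eq_of_le_of_card_ge hle hcard, MonoidHom.mem_ker, powMonoidHom_apply]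
  exact orderOf_dvd_iff_pow_eq_one.mp h

/-- The order of `1 + p^m a` (`p ∤ a`, `1 ≤ m ≤ N`, `p` odd) in `ℤ/p^N` is `p^{N−m}` (Mathlib `orderOf_one_add_mul_prime_pow`). [folklore] -/
theorem orderOf_one_add_pow_mul (hp2 : p ≠ 2) {N m : ℕ} (hm : m ≠ 0) (hmN : m ≤ N) (a : ℤ) (ha : ¬ (p : ℤ) ∣ a) :
    orderOf ((1 + (p : ZMod (p ^ N)) ^ m * a : ZMod (p ^ N))) = p ^ (N - m) := by
  obtain ⟨n, rfl⟩ := Nat.exists_eq_add_of_le' hmN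
  rw [Nat.add_sub_cancel]
  have hpm : m + 2 ≤ p * m := by
    have h3 : 3 ≤ p := by have := hp.out.two_le; omega
    calc m + 2 ≤ m + 2 * m := by omega
      _ = 3 * m := by ring
      _ ≤ p * m := Nat.mul_le_mul_right m h3
  have h := ZMod.orderOf_one_add_mul_prime_pow hp.out m hm hpm a ha n
  exact_mod_cast h

/-- `(1 + p^{N−1−b})^{p^b} = 1 + p^{N−1}` in `ℤ/p^N` for `p` odd and `N ≥ b + 2` (binomial expansion, Mathlib
`ZMod.exists_one_add_mul_pow_prime_pow_eq`: `(1 + p^m)^{p^b} = 1 + p^{m+b}(1 + p y)`). [folklore] -/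
theorem one_add_pow_pow_eq (hp2 : p ≠ 2) {N b : ℕ} (hN : b + 2 ≤ N) :
    ((1 + (p : ZMod (p ^ N)) ^ (N - 1 - b)) ^ p ^ b : ZMod (p ^ N)) = 1 + (p : ZMod (p ^ N)) ^ (N - 1) := by
  have hm : N - 1 - b ≠ 0 := by omega
  have h3 : 3 ≤ p := by have := hp.out.two_le; omega
  have hdiv : (p : ZMod (p ^ N)) * (p : ZMod (p ^ N)) ^ (N - 1 - b) * (p : ZMod (p ^ N)) ∣
      ((p : ZMod (p ^ N)) ^ (N - 1 - b)) ^ p := by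
    rw [← pow_succ', ← pow_succ, ← pow_mul]
    exact pow_dvd_pow _ (by nlinarith [Nat.one_le_iff_ne_zero.mpr hm])
  obtain ⟨y, hy⟩ := ZMod.exists_one_add_mul_pow_prime_pow_eq (R := ZMod (p ^ N)) (u := (p : ZMod (p ^ N)) ^ (N - 1 - b))
    (v := (p : ZMod (p ^ N))) hp.out (dvd_pow_self _ hm) hdiv 1 b
  rw [mul_one] at hy
  rw [hy]
  calc (1 : ZMod (p ^ N)) + (p : ZMod (p ^ N)) ^ b * (p : ZMod (p ^ N)) ^ (N - 1 - b) * (1 + (p : ZMod (p ^ N)) * y)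
      = 1 + (p : ZMod (p ^ N)) ^ (b + (N - 1 - b)) + (p : ZMod (p ^ N)) ^ (b + (N - 1 - b) + 1) * y := by
        rw [pow_succ, pow_add]; ring
    _ = 1 + (p : ZMod (p ^ N)) ^ (N - 1) := by
        rw [show b + (N - 1 - b) = N - 1 by omega, show N - 1 + 1 = N by omega, ← Nat.cast_pow p N, ZMod.natCast_self,
          zero_mul, add_zero]

omit hp in
/-- `(1 + p^{N−1})^m = 1 + m p^{N−1}` in `ℤ/p^N` (`N ≥ 2`: `p^{2(N−1)} = 0`). [folklore] -/
theorem one_add_pow_pred_pow {N : ℕ} (hN : 2 ≤ N) (m : ℕ) :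
    ((1 + (p : ZMod (p ^ N)) ^ (N - 1)) ^ m : ZMod (p ^ N)) = 1 + (m : ZMod (p ^ N)) * (p : ZMod (p ^ N)) ^ (N - 1) := by
  have hsq : ((p : ZMod (p ^ N)) ^ (N - 1)) * (p : ZMod (p ^ N)) ^ (N - 1) = 0 := by
    rw [← pow_add]
    obtain ⟨k, hk⟩ : ∃ k, N - 1 + (N - 1) = N + k := ⟨N - 2, by omega⟩
    rw [hk, pow_add, ← Nat.cast_pow, ZMod.natCast_self, zero_mul]
  induction m with
  | zero => simp
  | succ m ih =>
    rw [pow_succ, ih, Nat.cast_succ]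
    calc (1 + (m : ZMod (p ^ N)) * (p : ZMod (p ^ N)) ^ (N - 1)) * (1 + (p : ZMod (p ^ N)) ^ (N - 1))
        = 1 + ((m : ZMod (p ^ N)) + 1) * (p : ZMod (p ^ N)) ^ (N - 1) +
            (m : ZMod (p ^ N)) * (((p : ZMod (p ^ N)) ^ (N - 1)) * (p : ZMod (p ^ N)) ^ (N - 1)) := by ring
      _ = 1 + ((m : ZMod (p ^ N)) + 1) * (p : ZMod (p ^ N)) ^ (N - 1) := by rw [hsq, mul_zero, add_zero]

/-- **`1 + p^{N−1−b}` is a power of `ℓ^{p²−1}` in `(ℤ/p^N)ˣ`** for `p` odd, `p ∤ ℓ`, `N ≥ v_p(ℓ^{p²−1} − 1) + b + 1`, `N ≥ b + 2`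
(both lie in the cyclic group `(ℤ/p^N)ˣ`; orders `p^{b+1} ∣ p^{N−v}`). [folklore] -/
theorem exists_pow_eq_one_add_pow (hp2 : p ≠ 2) {N b ℓ : ℕ} (hℓ1 : 1 < ℓ) (hpℓ : ¬ p ∣ ℓ)
    (hN : padicValNat p (ℓ ^ (p ^ 2 - 1) - 1) + b + 1 ≤ N) (hN2 : b + 2 ≤ N)
    (σ g₁ : (ZMod (p ^ N))ˣ) (hσ : (σ : ZMod (p ^ N)) = ℓ) (hg₁ : (g₁ : ZMod (p ^ N)) = 1 + (p : ZMod (p ^ N)) ^ (N - 1 - b)) :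
    ∃ k : ℕ, (σ ^ (p ^ 2 - 1)) ^ k = g₁ := by
  haveI : IsCyclic (ZMod (p ^ N))ˣ := ZMod.isCyclic_units_of_prime_pow p hp.out hp2 N
  haveI : NeZero (p ^ N) := ⟨pow_ne_zero _ hp.out.ne_zero⟩
  -- `ℓ^{p²−1} = 1 + p^w a`, `p ∤ a`, `w ≥ 1`
  set M := p ^ 2 - 1 with hM
  have hM0 : M ≠ 0 := by
    have := hp.out.two_le; rw [hM]; have : 4 ≤ p ^ 2 := by nlinarith
    omega
  have hℓM1 : 1 < ℓ ^ M := Nat.one_lt_pow hM0 hℓ1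
  have hpdvd : p ∣ ℓ ^ M - 1 := by
    -- Fermat: `ℓ^{p-1} ≡ 1`, and `p − 1 ∣ p² − 1`
    have hcop : ℓ.Coprime p := ((Nat.Prime.coprime_iff_not_dvd hp.out).mpr hpℓ).symm
    have h1 : (ℓ : ZMod p) ^ M = 1 := by
      rw [hM, show p ^ 2 - 1 = (p - 1) * (p + 1) by simpa [mul_comm] using Nat.sq_sub_sq p 1, pow_mul,
        ZMod.pow_card_sub_one_eq_one, one_pow]
      intro h0; exact hpℓ ((ZMod.natCast_eq_zero_iff ℓ p).mp h0)
    have : ((ℓ ^ M - 1 : ℕ) : ZMod p) = 0 := by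
      rw [Nat.cast_sub hℓM1.le, Nat.cast_pow, h1, Nat.cast_one, sub_self]
    exact (ZMod.natCast_eq_zero_iff _ _).mp this
  set w := padicValNat p (ℓ ^ M - 1) with hw
  have hw1 : 1 ≤ w := by
    rw [hw]; exact one_le_padicValNat_of_dvd (Nat.sub_ne_zero_of_lt hℓM1) hpdvd
  obtain ⟨a, ha, hfac⟩ : ∃ a : ℕ, ¬ p ∣ a ∧ ℓ ^ M - 1 = p ^ w * a := by
    obtain ⟨a, hfac⟩ := pow_padicValNat_dvd (p := p) (n := ℓ ^ M - 1)
    refine ⟨a, fun hpa ↦ ?_, hfac⟩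
    have : p ^ (w + 1) ∣ ℓ ^ M - 1 := by rw [hfac, pow_succ]; exact mul_dvd_mul_left _ hpa
    exact pow_succ_padicValNat_not_dvd (Nat.sub_ne_zero_of_lt hℓM1) this
  have hwN : w ≤ N := by omega
  -- order of `U = σ^M`
  have hU : ((σ ^ M : (ZMod (p ^ N))ˣ) : ZMod (p ^ N)) = 1 + (p : ZMod (p ^ N)) ^ w * (a : ℤ) := by
    rw [Units.val_pow_eq_pow_val, hσ, Int.cast_natCast]
    have : ((ℓ ^ M : ℕ) : ZMod (p ^ N)) = ((1 + p ^ w * a : ℕ) : ZMod (p ^ N)) := by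
      congr 1; omega
    exact_mod_cast this
  have hordU : orderOf (σ ^ M) = p ^ (N - w) := by
    rw [← orderOf_units, hU]
    exact orderOf_one_add_pow_mul hp2 (by omega) hwN a (by exact_mod_cast ha)
  have hordg : orderOf g₁ = p ^ (b + 1) := by
    rw [← orderOf_units, hg₁]
    have h := orderOf_one_add_pow_mul (N := N) hp2 (m := N - 1 - b) (by omega) (by omega) 1
      (by exact_mod_cast hp.out.not_dvd_one)
    rw [Int.cast_one, mul_one, show N - (N - 1 - b) = b + 1 by omega] at h
    exact h
  have hdvd : orderOf g₁ ∣ orderOf (σ ^ M) := by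
    rw [hordU, hordg]; exact pow_dvd_pow p (by omega)
  obtain ⟨k, hk⟩ := Subgroup.mem_zpowers_iff.mp (mem_zpowers_of_orderOf_dvd hdvd)
  -- integer power ↦ natural power (finite order)
  refine ⟨(k % (orderOf (σ ^ M) : ℤ)).toNat, ?_⟩
  rw [← hk, ← zpow_natCast, Int.toNat_of_nonneg (Int.emod_nonneg _ (by
    rw [hordU]; exact_mod_cast pow_ne_zero _ hp.out.ne_zero)), zpow_mod_orderOf]

/-! ## §3 The annihilator lemma in `A = 𝔽_p[(ℤ/p^N)ˣ]` -/

omit hp in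
/-- A unit of `ℤ/p^N` with value `1 + p^{N−1−b}` (`N ≥ b + 2`). [folklore] -/
theorem exists_unit_eq_one_add_pow {N b : ℕ} (hN2 : b + 2 ≤ N) :
    ∃ g : (ZMod (p ^ N))ˣ, (g : ZMod (p ^ N)) = 1 + (p : ZMod (p ^ N)) ^ (N - 1 - b) := by
  have hcop : (1 + p ^ (N - 2 - b) * p).Coprime (p ^ N) :=
    ((Nat.coprime_add_mul_right_left 1 p (p ^ (N - 2 - b))).mpr (Nat.coprime_one_left p)).pow_right N
  refine ⟨ZMod.unitOfCoprime _ hcop, ?_⟩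
  rw [ZMod.coe_unitOfCoprime, ← pow_succ, show N - 2 - b + 1 = N - 1 - b by omega]
  push_cast
  rfl

/-- `𝔽_p[G]` has characteristic `p`. [folklore] -/
theorem charP_monoidAlgebra (G : Type*) [CommGroup G] : CharP (MonoidAlgebra (ZMod p) G) p := by
  refine charP_of_injective_algebraMap (R := ZMod p) (fun r s h ↦ ?_) p
  have := congrArg (fun x : MonoidAlgebra (ZMod p) G ↦ x.coeff 1) h
  simpa [MonoidAlgebra.coe_algebraMap] using this

/-- One Euler factor: `Q(δ_{σ⁻¹})` divides `(δ_{g₁} − 1)²` in `A` whenever `Q ∣ (Y^{p²−1} − 1)²` and `g₁ = (σ^{p²−1})^k`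
(`δ_{σ⁻¹}^{M}·δ_{σ^M} = 1`, geometric series `(δ_U − 1)·Σ_{j<k} δ_U^j = δ_{U^k} − 1`). [folklore] -/
theorem exists_aeval_single_mul_eq_sq {G : Type*} [CommGroup G] {Q : (ZMod p)[X]} {M : ℕ}
    (hQ : Q ∣ ((X : (ZMod p)[X]) ^ M - 1) ^ 2) (σ g₁ : G) {k : ℕ} (hk : (σ ^ M) ^ k = g₁) :
    ∃ F : MonoidAlgebra (ZMod p) G,
      aeval (MonoidAlgebra.single σ⁻¹ (1 : ZMod p)) Q * F = (MonoidAlgebra.single g₁ (1 : ZMod p) - 1) ^ 2 := by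
  obtain ⟨C, hC⟩ := hQ
  set x : MonoidAlgebra (ZMod p) G := MonoidAlgebra.single σ⁻¹ (1 : ZMod p) with hx
  set u : MonoidAlgebra (ZMod p) G := MonoidAlgebra.single (σ ^ M) (1 : ZMod p) with hu
  have hxu : x ^ M * u = 1 := by
    rw [hx, hu, MonoidAlgebra.single_pow, MonoidAlgebra.single_mul_single, one_pow, one_mul, inv_pow, inv_mul_cancel,
      MonoidAlgebra.one_def]
  have huk : u ^ k = MonoidAlgebra.single g₁ 1 := by rw [hu, MonoidAlgebra.single_pow, one_pow, hk]
  have hQC : aeval x Q * aeval x C = (x ^ M - 1) ^ 2 := by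
    rw [← map_mul, ← hC, map_pow, map_sub, map_pow, aeval_X, map_one]
  refine ⟨aeval x C * u ^ 2 * (∑ j ∈ Finset.range k, u ^ j) ^ 2, ?_⟩
  have hgeom : (∑ j ∈ Finset.range k, u ^ j) * (u - 1) = MonoidAlgebra.single g₁ 1 - 1 := by rw [geom_sum_mul, huk]
  calc aeval x Q * (aeval x C * u ^ 2 * (∑ j ∈ Finset.range k, u ^ j) ^ 2)
      = (aeval x Q * aeval x C) * u ^ 2 * (∑ j ∈ Finset.range k, u ^ j) ^ 2 := by ring
    _ = ((x ^ M * u) * (u - 1) - u * (x ^ M * u - 1)) ^ 2 * (∑ j ∈ Finset.range k, u ^ j) ^ 2 := by rw [hQC]; ring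
    _ = ((∑ j ∈ Finset.range k, u ^ j) * (u - 1)) ^ 2 := by rw [hxu]; ring
    _ = (MonoidAlgebra.single g₁ 1 - 1) ^ 2 := by rw [hgeom]

/-- ★ §3 **The annihilator lemma.** `p` odd, `N ≥ b + 2`, a finite family of integers `ℓ_i > 1` prime to `p` with classes
`σ_i ∈ (ℤ/p^N)ˣ` and `N ≥ v_p(ℓ_i^{p²−1} − 1) + b + 1`, polynomials `Q_i ∈ 𝔽_p[Y]` of degree `≤ 2` with `Q_i(0) ≠ 0`, and
`2·#ι ≤ p^b`. If the depletion operator `E = ∏_i Q_i(δ_{σ_i⁻¹})` kills `θ ∈ 𝔽_p[(ℤ/p^N)ˣ]`, then `δ_{1+p^{N−1}}·θ = θ`.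
Proof: `E·F = (δ_{g₁} − 1)^{2#ι}` (`exists_aeval_single_mul_eq_sq` with `g₁ = 1 + p^{N−1−b} ∈ ⟨σ_i^{p²−1}⟩`), so `(δ_{g₁} − 1)^{p^b}·θ = 0`,
and `(δ_{g₁} − 1)^{p^b} = δ_{g₁^{p^b}} − 1 = δ_{1+p^{N−1}} − 1` (Frobenius in characteristic `p`). [folklore] -/
theorem single_mul_eq_self_of_depletion_mul_eq_zero (hp2 : p ≠ 2) {N b : ℕ} {ι : Type*} [Fintype ι]
    (ℓ : ι → ℕ) (hℓ : ∀ i, 1 < ℓ i ∧ ¬ p ∣ ℓ i) (σ : ι → (ZMod (p ^ N))ˣ) (hσ : ∀ i, (σ i : ZMod (p ^ N)) = ℓ i)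
    (Q : ι → (ZMod p)[X]) (hdeg : ∀ i, (Q i).natDegree ≤ 2) (h0 : ∀ i, (Q i).coeff 0 ≠ 0)
    (hb : 2 * Fintype.card ι ≤ p ^ b) (hN2 : b + 2 ≤ N) (hN : ∀ i, padicValNat p (ℓ i ^ (p ^ 2 - 1) - 1) + b + 1 ≤ N)
    (g₂ : (ZMod (p ^ N))ˣ) (hg₂ : (g₂ : ZMod (p ^ N)) = 1 + (p : ZMod (p ^ N)) ^ (N - 1))
    (θ : MonoidAlgebra (ZMod p) (ZMod (p ^ N))ˣ)
    (hθ : (∏ i, aeval (MonoidAlgebra.single (σ i)⁻¹ (1 : ZMod p)) (Q i)) * θ = 0) :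
    MonoidAlgebra.single g₂ (1 : ZMod p) * θ = θ := by
  haveI : CharP (MonoidAlgebra (ZMod p) (ZMod (p ^ N))ˣ) p := charP_monoidAlgebra _
  obtain ⟨g₁, hg₁⟩ := exists_unit_eq_one_add_pow (p := p) hN2
  -- cofactors
  have hF : ∀ i, ∃ F : MonoidAlgebra (ZMod p) (ZMod (p ^ N))ˣ,
      aeval (MonoidAlgebra.single (σ i)⁻¹ (1 : ZMod p)) (Q i) * F = (MonoidAlgebra.single g₁ (1 : ZMod p) - 1) ^ 2 := by
    intro i
    obtain ⟨k, hk⟩ := exists_pow_eq_one_add_pow hp2 (hℓ i).1 (hℓ i).2 (hN i) hN2 (σ i) g₁ (hσ i) hg₁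
    exact exists_aeval_single_mul_eq_sq (dvd_X_pow_sub_one_sq (hdeg i) (h0 i)) (σ i) g₁ hk
  choose F hF using hF
  set D : MonoidAlgebra (ZMod p) (ZMod (p ^ N))ˣ := MonoidAlgebra.single g₁ (1 : ZMod p) - 1 with hD
  have hprod : (∏ i, aeval (MonoidAlgebra.single (σ i)⁻¹ (1 : ZMod p)) (Q i)) * ∏ i, F i = D ^ (2 * Fintype.card ι) := by
    rw [← Finset.prod_mul_distrib, Finset.prod_congr rfl fun i _ ↦ hF i, Finset.prod_const, Finset.card_univ, ← pow_mul,
      mul_comm]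
  -- `D^{p^b} θ = 0`
  have hDθ : D ^ (p ^ b) * θ = 0 := by
    obtain ⟨c, hc⟩ := Nat.exists_eq_add_of_le hb
    rw [hc, pow_add, mul_comm (D ^ (2 * Fintype.card ι)), mul_assoc, ← hprod, mul_comm (∏ i, _) (∏ i, F i), mul_assoc, hθ,
      mul_zero, mul_zero]
  -- Frobenius
  have hfrob : D ^ (p ^ b) = MonoidAlgebra.single g₂ (1 : ZMod p) - 1 := by
    rw [hD, sub_pow_char_pow, one_pow, MonoidAlgebra.single_pow, one_pow]
    congr 2
    ext
    rw [Units.val_pow_eq_pow_val, hg₁, hg₂, one_add_pow_pow_eq hp2 hN2]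
  rw [hfrob, sub_mul, one_mul, sub_eq_zero] at hDθ
  exact hDθ

/-! ## §4 The annihilator lemma for FUNCTIONS on `(ℤ/p^N)ˣ`: depletion-invisible functions are constant on the fibres of
`(ℤ/p^N)ˣ → (ℤ/p^{N−1})ˣ` -/

/-- The depletion operator EXPANDED: `((∏_i Q_i(δ_{σ_i⁻¹}))·θ)(a) = Σ_{k : ι → {0,1,2}} (∏_i [Y^{k_i}]Q_i) · θ(∏_i σ_i^{k_i} · a)`.
[cite: GreenbergVatsal2000, §1 (8)–(9)] -/
theorem coeff_prod_aeval_single_mul {N : ℕ} {ι : Type*} [Fintype ι] [DecidableEq ι] (σ : ι → (ZMod (p ^ N))ˣ)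
    (Q : ι → (ZMod p)[X]) (hdeg : ∀ i, (Q i).natDegree ≤ 2) (θ : MonoidAlgebra (ZMod p) (ZMod (p ^ N))ˣ) (a : (ZMod (p ^ N))ˣ) :
    ((∏ i, aeval (MonoidAlgebra.single (σ i)⁻¹ (1 : ZMod p)) (Q i)) * θ).coeff a =
      ∑ k ∈ Fintype.piFinset (fun _ : ι ↦ Finset.range 3), (∏ i, (Q i).coeff (k i)) * θ.coeff ((∏ i, σ i ^ (k i)) * a) := by
  have hexp : ∀ i, aeval (MonoidAlgebra.single (σ i)⁻¹ (1 : ZMod p)) (Q i) =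
      ∑ j ∈ Finset.range 3, MonoidAlgebra.single ((σ i)⁻¹ ^ j) ((Q i).coeff j) := by
    intro i
    rw [aeval_eq_sum_range' (show (Q i).natDegree < 3 by have := hdeg i; omega)]
    refine Finset.sum_congr rfl fun j _ ↦ ?_
    rw [MonoidAlgebra.single_pow, one_pow, MonoidAlgebra.smul_single', mul_one]
  rw [Finset.prod_congr rfl fun i _ ↦ hexp i, Finset.prod_univ_sum, Finset.sum_mul, MonoidAlgebra.coeff_sum,
    Finsupp.finsetSum_apply]
  refine Finset.sum_congr rfl fun k _ ↦ ?_
  rw [MonoidAlgebra.prod_single, MonoidAlgebra.coeff_single_mul_apply]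
  simp only [← Finset.prod_inv_distrib, inv_pow, inv_inv]

/-- ★ §4 **Depletion-invisible functions are `(1 + p^{N−1})`-periodic.** Same arithmetic hypotheses as §3; for a function
`c : (ℤ/p^N)ˣ → 𝔽_p` with `Σ_{k : ι → {0,1,2}} (∏_i [Y^{k_i}]Q_i)·c(∏_i σ_i^{k_i}·a) = 0` for every `a` (all depleted values vanish)
and `g₂ = 1 + p^{N−1}`: `c(a·g₂^m) = c(a)` for all `a, m`. [folklore] -/
theorem apply_mul_pow_eq_of_depletion_sum_eq_zero (hp2 : p ≠ 2) {N b : ℕ} {ι : Type*} [Fintype ι] [DecidableEq ι]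
    (ℓ : ι → ℕ) (hℓ : ∀ i, 1 < ℓ i ∧ ¬ p ∣ ℓ i) (σ : ι → (ZMod (p ^ N))ˣ) (hσ : ∀ i, (σ i : ZMod (p ^ N)) = ℓ i)
    (Q : ι → (ZMod p)[X]) (hdeg : ∀ i, (Q i).natDegree ≤ 2) (h0 : ∀ i, (Q i).coeff 0 ≠ 0)
    (hb : 2 * Fintype.card ι ≤ p ^ b) (hN2 : b + 2 ≤ N) (hN : ∀ i, padicValNat p (ℓ i ^ (p ^ 2 - 1) - 1) + b + 1 ≤ N)
    (g₂ : (ZMod (p ^ N))ˣ) (hg₂ : (g₂ : ZMod (p ^ N)) = 1 + (p : ZMod (p ^ N)) ^ (N - 1))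
    (c : (ZMod (p ^ N))ˣ → ZMod p)
    (hc : ∀ a, ∑ k ∈ Fintype.piFinset (fun _ : ι ↦ Finset.range 3),
      (∏ i, (Q i).coeff (k i)) * c ((∏ i, σ i ^ (k i)) * a) = 0)
    (a : (ZMod (p ^ N))ˣ) (m : ℕ) : c (a * g₂ ^ m) = c a := by
  set θ : MonoidAlgebra (ZMod p) (ZMod (p ^ N))ˣ := MonoidAlgebra.ofCoeff (Finsupp.equivFunOnFinite.symm c) with hθdef
  have hθ : ∀ x, θ.coeff x = c x := fun x ↦ by simp [hθdef]
  have hE : (∏ i, aeval (MonoidAlgebra.single (σ i)⁻¹ (1 : ZMod p)) (Q i)) * θ = 0 := by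
    refine MonoidAlgebra.ext (Finsupp.ext fun x ↦ ?_)
    rw [coeff_prod_aeval_single_mul σ Q hdeg θ x, MonoidAlgebra.coeff_zero, Finsupp.zero_apply]
    simpa only [hθ] using hc x
  have hinv := single_mul_eq_self_of_depletion_mul_eq_zero hp2 ℓ hℓ σ hσ Q hdeg h0 hb hN2 hN g₂ hg₂ θ hE
  have hstep : ∀ x, c (g₂ * x) = c x := fun x ↦ by
    have h := congrArg (fun y : MonoidAlgebra (ZMod p) (ZMod (p ^ N))ˣ ↦ y.coeff (g₂ * x)) hinv
    simp only [MonoidAlgebra.coeff_single_mul_apply, one_mul, inv_mul_cancel_left, hθ] at h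
    exact h.symm
  induction m with
  | zero => rw [pow_zero, mul_one]
  | succ m ih => rw [pow_succ, ← mul_assoc, mul_comm _ g₂, hstep, ih]

/-- ★ §4, fibre form: under the same hypotheses, **for every unit `a` and every `t`, the class `a + t·p^{N−1}` is a unit `u` of
`ℤ/p^N` with `c(u) = c(a)`** (`u = a·g₂^{t·a⁻¹}`, `(1 + p^{N−1})^m = 1 + m p^{N−1}`): a depletion-invisible function is CONSTANT on the
fibres of `(ℤ/p^N)ˣ → (ℤ/p^{N−1})ˣ`. [folklore] -/
theorem exists_unit_eq_add_mul_and_apply_eq (hp2 : p ≠ 2) {N b : ℕ} {ι : Type*} [Fintype ι] [DecidableEq ι]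
    (ℓ : ι → ℕ) (hℓ : ∀ i, 1 < ℓ i ∧ ¬ p ∣ ℓ i) (σ : ι → (ZMod (p ^ N))ˣ) (hσ : ∀ i, (σ i : ZMod (p ^ N)) = ℓ i)
    (Q : ι → (ZMod p)[X]) (hdeg : ∀ i, (Q i).natDegree ≤ 2) (h0 : ∀ i, (Q i).coeff 0 ≠ 0)
    (hb : 2 * Fintype.card ι ≤ p ^ b) (hN2 : b + 2 ≤ N) (hN : ∀ i, padicValNat p (ℓ i ^ (p ^ 2 - 1) - 1) + b + 1 ≤ N)
    (c : (ZMod (p ^ N))ˣ → ZMod p)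
    (hc : ∀ a, ∑ k ∈ Fintype.piFinset (fun _ : ι ↦ Finset.range 3),
      (∏ i, (Q i).coeff (k i)) * c ((∏ i, σ i ^ (k i)) * a) = 0)
    (a : (ZMod (p ^ N))ˣ) (t : ℕ) :
    ∃ u : (ZMod (p ^ N))ˣ, (u : ZMod (p ^ N)) = a + t * (p : ZMod (p ^ N)) ^ (N - 1) ∧ c u = c a := by
  have hN1 : 2 ≤ N := by omega
  obtain ⟨g₂, hg₂⟩ := exists_unit_eq_one_add_pow (p := p) (N := N) (b := 0) hN1
  rw [Nat.sub_zero] at hg₂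
  refine ⟨a * g₂ ^ (t * ((a⁻¹ : (ZMod (p ^ N))ˣ) : ZMod (p ^ N)).val), ?_,
    apply_mul_pow_eq_of_depletion_sum_eq_zero hp2 ℓ hℓ σ hσ Q hdeg h0 hb hN2 hN g₂ hg₂ c hc a _⟩
  rw [Units.val_mul, Units.val_pow_eq_pow_val, hg₂, one_add_pow_pred_pow hN1, Nat.cast_mul, ZMod.natCast_zmod_val, mul_add,
    mul_one]
  congr 1
  calc (a : ZMod (p ^ N)) * ((t : ZMod (p ^ N)) * ((a⁻¹ : (ZMod (p ^ N))ˣ) : ZMod (p ^ N)) * (p : ZMod (p ^ N)) ^ (N - 1))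
      = (t : ZMod (p ^ N)) * ((a : ZMod (p ^ N)) * ((a⁻¹ : (ZMod (p ^ N))ˣ) : ZMod (p ^ N))) * (p : ZMod (p ^ N)) ^ (N - 1) := by
        ring
    _ = t * (p : ZMod (p ^ N)) ^ (N - 1) := by rw [Units.mul_inv, mul_one]



end Summit.BirchSwinnertonDyer.BirchSwinnertonDyer.Theorems.SmallImageValve

end
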